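import Mathlib
import Literature.Analysis.FluidPDE.VectorCalculus
import Summits.NavierStokesRegularity.NavierStokesRegularity.Theorems.ThreadingFluxErtelTowerStagnationConeTip
import HarnessLib

/-!
# Crux `PoloidalLiouville` (stmt-NavierStokesRegularity-1222, W1), crux idea «radial-jerk-tower» (ns-idea-15 g7):
# THE SMOOTH 1-JET TEST — local inviscid rigidity about every centre of a smooth steady drift

Support file (`--supports stmt-NavierStokesRegularity-1222`, helper).  Experiment cell `ns-wall-extremal`, width hand
ns-wall-eng-5 g10, item (ε) E7c (rider on E7a/E7b, `…ErtelTowerStagnationGerms` / `…ErtelTowerStagnationConeTip`).  0 kit.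
Theorem-only; nothing of the sketch `Cruxes/PoloidalLiouville/ErtelTowerSketch.lean` is restated or closed.

E6b's `inviscidJetRigidity_analytic` is the 1-jet test for REAL-ANALYTIC steady drifts (conclusion on all of `I × U`).  For SMOOTH
drifts the two halves of the test are LOCAL: E5 `inviscidJetRigidity_nonStagnation` (`v × (A v + 2A† v) ≠ 0` ⇒ rigidity on a BALL
about `x₀`) and E7b `inviscidJetRigidity_stagnation_smooth` (`v = 0`, `A` commuting with no rotation generator ⇒ rigidity on a CONE TIP
at `x₀`).  This file states them as ONE local test, for frozen fields and for smooth steady Euler flows: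

* ★★★ `inviscidJetRigidity_smooth` — **THE SMOOTH 1-JET TEST: `u` smooth on an open `U ∋ x₀`, `v = u(x₀)`, `A = Du(x₀)`; if EITHER
  `v × (A v + 2A† v) ≠ 0` OR `v = 0` and `A` commutes with no rotation generator, then there is an open `V ⊆ U` with `x₀ ∈ closure V`
  such that every smooth field frozen into `u` on `I × U` and tangent to the spheres about `x₀` vanishes on `I × V` and AT `x₀`**;
* `jetVector_steadyEuler_of_differentiableAt` — E6b's `jetVector_steadyEuler` (`A v + 2A† v = ∇(‖v‖² − p)(x₀)` on Euler pairs) under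
  mere differentiability at `x₀` (E6b stated it for analytic `v`);
* ★★ `steadyEuler_curl_eq_zero_near_of_jet_smooth` — **a SMOOTH steady incompressible Euler pair `(v, p)` on `U` whose vortex lines are
  tangent to the spheres about `x₀ ∈ U`, passing the 1-jet test at `x₀` (`v(x₀) × ∇(‖v‖² − p)(x₀) ≠ 0`, or `v(x₀) = 0` with `Dv(x₀)`
  commuting with no rotation generator), is IRROTATIONAL on an open `V ⊆ U` with `x₀ ∈ closure V`, and `curl v (x₀) = 0`.**

HONEST FRAME: LOCAL statements about the INVISCID shadow (frozen-field equation) in a prescribed SMOOTH steady drift and about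
unthreaded smooth steady EULER flows; information-grade helper under ⟨1222⟩; says nothing about NS; `PoloidalLiouville` (1222) /
`UnthreadedRigidity` (27585) OPEN; NS regularity NOT proved.
-/

-- the summit and its single problem share the name (D-0017 nested layout)
set_option linter.dupNamespace false

noncomputable section

namespace Summit.NavierStokesRegularity.NavierStokesRegularity.Theorems.PoloidalLiouville.ErtelTower

open Set Function Filter Metric Topology
open scoped Topology RealInnerProductSpace InnerProductSpace ContDiff
open Literature.Analysis.FluidPDE
open Summit.NavierStokesRegularity.NavierStokesRegularity.Theorems.PoloidalLiouville.HorizonTower (E3)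

/-! ### The smooth 1-jet test for frozen fields -/

section JetTest

/-- ★★★ **THE SMOOTH 1-JET TEST (local inviscid rigidity about every centre).**  Let `u` be smooth on an open `U ∋ x₀`,
`v = u(x₀)`, `A = Du(x₀)`.  If EITHER `v × (A v + 2A† v) ≠ 0` (E5: then `V` is a ball about `x₀`), OR `v = 0` and `A` commutes with
no rotation generator `z ↦ w × z`, `w ≠ 0` (E7b: then `V` is a cone tip at `x₀`), there is an OPEN `V ⊆ U` with `x₀ ∈ closure V` such
that EVERY smooth field `B` frozen into `u` on `I × U` (`I` open: `∂ₜB + DB[u] − Du[B] = 0`) and tangent to the spheres about `x₀`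
vanishes on `I × V` and at the centre: `B t x₀ = 0` for all `t ∈ I`.
(`inviscidJetRigidity_nonStagnation` E5 / `inviscidJetRigidity_stagnation_smooth` E7b BY NAME; E6b's `inviscidJetRigidity_analytic` is the
global form for real-analytic drifts.) -/
theorem inviscidJetRigidity_smooth (u : E3 → E3) (x₀ : E3) (U : Set E3) (hU : IsOpen U) (hx₀ : x₀ ∈ U)
    (hu : ContDiffOn ℝ (⊤ : ℕ∞) u U)
    (hjet : cross (u x₀) (fderiv ℝ u x₀ (u x₀) + (2 : ℝ) • (ContinuousLinearMap.adjoint (fderiv ℝ u x₀)) (u x₀)) ≠ 0 ∨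
      (u x₀ = 0 ∧ ¬ ∃ w : E3, w ≠ 0 ∧ ∀ z : E3, fderiv ℝ u x₀ (cross w z) = cross w (fderiv ℝ u x₀ z))) :
    ∃ V : Set E3, IsOpen V ∧ V ⊆ U ∧ x₀ ∈ closure V ∧
      ∀ (B : ℝ → E3 → E3) (I : Set ℝ), IsOpen I → ContDiffOn ℝ (⊤ : ℕ∞) (uncurry B) (I ×ˢ U) →
        (∀ t ∈ I, ∀ x ∈ U, deriv (fun s => B s x) t + fderiv ℝ (B t) x (u x) - fderiv ℝ u x (B t x) = 0) →
        (∀ t ∈ I, ∀ x ∈ U, ⟪B t x, x - x₀⟫ = 0) →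
        (∀ t ∈ I, ∀ x ∈ V, B t x = 0) ∧ ∀ t ∈ I, B t x₀ = 0 := by
  rcases hjet with hjet | ⟨hstag, hA⟩
  · -- E5: rigidity on a ball about `x₀`
    obtain ⟨r, hr, hball, hrig⟩ := inviscidJetRigidity_nonStagnation u x₀ U hU hx₀ hu hjet
    refine ⟨Metric.ball x₀ r, Metric.isOpen_ball, hball, subset_closure (Metric.mem_ball_self hr),
      fun B I hI hB hfrozen htan => ?_⟩
    have hzero : ∀ t ∈ I, ∀ x ∈ Metric.ball x₀ r, B t x = 0 :=
      hrig B I hI (hB.mono (prod_mono Subset.rfl hball)) (fun t ht x hx => hfrozen t ht x (hball hx))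
        fun t ht x hx => htan t ht x (hball hx)
    exact ⟨hzero, fun t ht => hzero t ht x₀ (Metric.mem_ball_self hr)⟩
  · -- E7b: rigidity on a cone tip at `x₀`
    obtain ⟨V, hV, hVU, hx₀V, hVB⟩ := inviscidJetRigidity_stagnation_smooth u x₀ U hU hx₀ hu hstag hA
    refine ⟨V, hV, hVU, hx₀V, fun B I hI hB hfrozen htan => ?_⟩
    obtain ⟨hzero, -, hcentre⟩ := hVB B I hI hB hfrozen htan
    exact ⟨hzero, hcentre⟩

end JetTest

/-! ### Smooth steady Euler flows -/

section SteadyEuler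

variable {v : E3 → E3} {p : E3 → ℝ} {x₀ : E3}

/-- For a steady Euler pair the jet vector at `x₀` is `∇(‖v‖² − p)(x₀)`:  `A v + 2A† v = ∇(‖v‖² − p)(x₀)`, `v = v(x₀)`, `A = Dv(x₀)`
— E6b's `jetVector_steadyEuler` under mere differentiability of `v`, `p` at `x₀` and the Euler equation at `x₀`
(`gradient_inner_self_drift`, E5). -/
theorem jetVector_steadyEuler_of_differentiableAt (hvd : DifferentiableAt ℝ v x₀) (hpd : DifferentiableAt ℝ p x₀)
    (heuler : fderiv ℝ v x₀ (v x₀) + gradient p x₀ = 0) :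
    fderiv ℝ v x₀ (v x₀) + (2 : ℝ) • (ContinuousLinearMap.adjoint (fderiv ℝ v x₀)) (v x₀)
      = gradient (fun y : E3 => ⟪v y, v y⟫ - p y) x₀ := by
  have h1 : DifferentiableAt ℝ (fun y : E3 => ⟪v y, v y⟫) x₀ := hvd.inner ℝ hvd
  have hsub : (fun y : E3 => ⟪v y, v y⟫ - p y) = (fun y : E3 => ⟪v y, v y⟫) - p := rfl
  rw [hsub, gradient, fderiv_sub h1 hpd, map_sub]
  change _ = gradient (fun y : E3 => ⟪v y, v y⟫) x₀ - gradient p x₀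
  rw [gradient_inner_self_drift hvd, eq_sub_iff_add_eq, add_right_comm, heuler, zero_add]

/-- ★★ **THE SMOOTH 1-JET TEST FOR UNTHREADED STEADY EULER FLOWS (local form).**  Let `(v, p)` be a SMOOTH steady incompressible
Euler pair on an open `U` (`Dv[v] + ∇p = 0`, `div v = 0`) whose vortex lines are tangent to the spheres about `x₀ ∈ U`
(`⟪curl v, x − x₀⟫ = 0` on `U`).  If EITHER `v(x₀) × ∇(‖v‖² − p)(x₀) ≠ 0` OR `v(x₀) = 0` and `Dv(x₀)` commutes with no rotation
generator, then `v` is IRROTATIONAL on an open `V ⊆ U` with `x₀ ∈ closure V`, and `curl v (x₀) = 0`.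
(`vorticity_frozen` / `contDiffOn_curl_uncurry` + `inviscidJetRigidity_smooth`; E6b's `steadyEuler_curl_eq_zero_of_jet` /
`_of_stagnation` give `curl v ≡ 0` on `U` when `v` is real-analytic.) -/
theorem steadyEuler_curl_eq_zero_near_of_jet_smooth (v : E3 → E3) (p : E3 → ℝ) (x₀ : E3) (U : Set E3)
    (hU : IsOpen U) (hx₀ : x₀ ∈ U) (hv : ContDiffOn ℝ (⊤ : ℕ∞) v U) (hp : ContDiffOn ℝ (⊤ : ℕ∞) p U)
    (heuler : ∀ x ∈ U, fderiv ℝ v x (v x) + gradient p x = 0)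
    (hdiv : ∀ x ∈ U, Literature.Analysis.FluidPDE.VectorCalculus.divergence v x = 0)
    (hunthr : ∀ x ∈ U, ⟪curl v x, x - x₀⟫ = 0)
    (hjet : cross (v x₀) (gradient (fun y : E3 => ⟪v y, v y⟫ - p y) x₀) ≠ 0 ∨
      (v x₀ = 0 ∧ ¬ ∃ w : E3, w ≠ 0 ∧ ∀ z : E3, fderiv ℝ v x₀ (cross w z) = cross w (fderiv ℝ v x₀ z))) :
    ∃ V : Set E3, IsOpen V ∧ V ⊆ U ∧ x₀ ∈ closure V ∧ (∀ x ∈ V, curl v x = 0) ∧ curl v x₀ = 0 := by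
  -- the jet condition in E5's form
  have hvd : DifferentiableAt ℝ v x₀ := (hv.differentiableOn (by simp)).differentiableAt (hU.mem_nhds hx₀)
  have hpd : DifferentiableAt ℝ p x₀ := (hp.differentiableOn (by simp)).differentiableAt (hU.mem_nhds hx₀)
  have hjet' : cross (v x₀) (fderiv ℝ v x₀ (v x₀) + (2 : ℝ) • (ContinuousLinearMap.adjoint (fderiv ℝ v x₀)) (v x₀)) ≠ 0 ∨
      (v x₀ = 0 ∧ ¬ ∃ w : E3, w ≠ 0 ∧ ∀ z : E3, fderiv ℝ v x₀ (cross w z) = cross w (fderiv ℝ v x₀ z)) := by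
    rcases hjet with hjet | h
    · left
      rwa [jetVector_steadyEuler_of_differentiableAt hvd hpd (heuler x₀ hx₀)]
    · exact Or.inr h
  obtain ⟨V, hV, hVU, hx₀V, hVB⟩ := inviscidJetRigidity_smooth v x₀ U hU hx₀ hv hjet'
  -- the steady pair read on `univ × U`; the vorticity is frozen
  have hv' : ContDiffOn ℝ (⊤ : ℕ∞) (uncurry fun (_ : ℝ) (z : E3) => v z) ((univ : Set ℝ) ×ˢ U) :=
    hv.comp contDiffOn_snd fun q hq => hq.2
  have hp' : ContDiffOn ℝ (⊤ : ℕ∞) (uncurry fun (_ : ℝ) (z : E3) => p z) ((univ : Set ℝ) ×ˢ U) :=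
    hp.comp contDiffOn_snd fun q hq => hq.2
  have heuler' : ∀ t ∈ (univ : Set ℝ), ∀ x ∈ U,
      deriv (fun _ : ℝ => v x) t + fderiv ℝ v x (v x) + gradient p x = 0 := by
    intro t _ x hx
    rw [deriv_const, zero_add]
    exact heuler x hx
  have hB : ContDiffOn ℝ (⊤ : ℕ∞) (uncurry fun (t : ℝ) (x : E3) => curl ((fun _ : ℝ => v) t) x) ((univ : Set ℝ) ×ˢ U) :=
    contDiffOn_curl_uncurry hv' isOpen_univ hU
  have hfrozen := vorticity_frozen (v := fun _ : ℝ => v) (p := fun _ : ℝ => p) isOpen_univ hU hv' hp' heuler'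
    (fun _ _ y hy => hdiv y hy)
  obtain ⟨hzero, hcentre⟩ := hVB (fun (_ : ℝ) (x : E3) => curl v x) univ isOpen_univ hB hfrozen
    (fun _ _ y hy => hunthr y hy)
  exact ⟨V, hV, hVU, hx₀V, fun x hx => hzero 0 (mem_univ _) x hx, hcentre 0 (mem_univ _)⟩

end SteadyEuler

end Summit.NavierStokesRegularity.NavierStokesRegularity.Theorems.PoloidalLiouville.ErtelTower

end
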